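import Mathlib
import HarnessLib
import Literature.NumberTheory.EllipticCurves.NewformsLevelRaising
import Literature.NumberTheory.EllipticCurves.ModularCurveSturmProofs

/-!
# The real dimension of `S_k(Γ₀(N))` is monotone in the level

For `M ∣ N` the oldform inclusion `f(τ) ↦ f(τ)` (the degeneracy map `ι_d` with `d = 1`,
`Literature.NumberTheory.EllipticCurves.ModularForms.iota M N 1 k`) is an injective `ℂ`-linear map
`S_k(Γ₀(M)) → S_k(Γ₀(N))`; restricting scalars to `ℝ` and using the finite-dimensionality of
`S_k(Γ₀(N))` (Sturm's bound, `finiteDimensional_cuspForm_gamma0`) gives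
`rank_ℝ S_k(Γ₀(M)) ≤ rank_ℝ S_k(Γ₀(N))`.
-/

set_option linter.dupNamespace false

namespace Summit.ABC.ABC.Theorems.ReceptacleIdentitySketch

open CongruenceSubgroup
open scoped MatrixGroups ModularForm
open Literature.NumberTheory.EllipticCurves.ModularForms

/-- Mathlib's real and complex scalar multiplications on `CuspForm Γ k` (both defined pointwise)
are compatible: `(r • c) • f = r • (c • f)`. -/
private theorem isScalarTower_real_complex_cuspForm (Γ : Subgroup (GL (Fin 2) ℝ)) [Γ.HasDetOne]
    (k : ℤ) : IsScalarTower ℝ ℂ (CuspForm Γ k) :=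
  ⟨fun r c f ↦ DFunLike.coe_injective (by ext z; simp [mul_assoc])⟩

/-- **The rank of `S_k(Γ₀(·))` is monotone in the level.** For `M ∣ N` (both nonzero) and any
weight `k`, `rank_ℝ S_k(Γ₀(M)) ≤ rank_ℝ S_k(Γ₀(N))`: the oldform inclusion `iota M N 1 k`
(`f(τ) ↦ f(τ)`) is injective and `ℂ`-linear, hence `ℝ`-linear, and `S_k(Γ₀(N))` is
finite-dimensional over `ℂ`, hence over `ℝ`. -/
theorem stub_finrankMono (M N : ℕ) [NeZero M] [NeZero N] (k : ℤ) (h : M ∣ N) :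
    Module.finrank ℝ (CuspForm (Gamma0 M) k) ≤ Module.finrank ℝ (CuspForm (Gamma0 N) k) := by
  haveI := isScalarTower_real_complex_cuspForm (Gamma0 M) k
  haveI := isScalarTower_real_complex_cuspForm (Gamma0 N) k
  haveI : FiniteDimensional ℂ (CuspForm (Gamma0 N) k) := finiteDimensional_cuspForm_gamma0 N k
  haveI : Module.Finite ℝ (CuspForm (Gamma0 N) k) := Module.Finite.trans ℂ (CuspForm (Gamma0 N) k)
  have h1 : M * 1 ∣ N := by rwa [mul_one]
  exact LinearMap.finrank_le_finrank_of_injective (f := (iota M N 1 k h1).restrictScalars ℝ)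
    (iota_injective M N 1 k h1)

end Summit.ABC.ABC.Theorems.ReceptacleIdentitySketch
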